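import Summits.HodgeConjecture.HodgeConjecture.Theorems.Ring2WeilCoverageProductWindow
import Summits.HodgeConjecture.HodgeConjecture.Theorems.Ring2WeilNormObstructionDescentCensus
import HarnessLib

/-!
# Weil-type family coverage — THEOREM S7 (carrier-free product-window law), part J: the window `SD₁₆ × PSL₃(3)` (`PSL₃(3)` on the 13 points of
# `PG(2,3)`) and the row `W6.2.13 = (3, ℚ(√-2), [13])` REACHED by a rigid curve of genus 11233; tenfolds on `W10.2.13`

research route conditional on HC_CM; not a corollary; Q11.4-sentence-2 already refuted in dim ≥ 3.

Ring 2, WEIL-TYPE FAMILY-COVERAGE CENSUS (`HOME/WEIL-FAMILY-COVERAGE.md` `## b04`, block b04.14 P.S. 2, owner ring2-b04, gen 50); tenth part of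
`Ring2WeilCoverageProductWindow` (imports part A only — part H's `carrierWindow_mk_eq_mk_pow` is re-derived inline in §1, so that this
part elaborates independently of the build queue).  Carrier `SD₁₆` (semidihedral of
order 16, `λ = Ind ζ₈`, `K = ℚ(√-2)`, `S_in = ∅`), `G₂ = PSL₃(3) = SL₃(3)` acting 2-transitively on the 13 points of the projective plane over
`𝔽₃` (`n = 13 ≡ 5 (mod 8)`, inert in `ℚ(√-2)`; point stabiliser of order 432); `|G| = 89856`, but the hidden factor lives on the coset cover
`C̃/(⟨y⟩ × Stab)` with 104 sheets and genus 9, where the engine (`cosetwin.py`, exact rational arithmetic) computes it in minutes; admissibility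
of the branch data is decided EXACTLY (`census-g50/bundle4/admiss.py`: all product-one triples with the involution fixed, generation by closure).
THEOREM S7 predicts `[a_B] = [13]^{r₁}`; the data below have `r₁ = 1`.
* §1 `carrierWindow_SD16L33_odd_not_mem_norm`: for ANY carrier constant `u ≠ 0` and odd `r₁`, the predicted class
  `[(13·432·u)^{r₁}·(432·u)^{r₁+2k}] = [13]` is NOT a norm class from `ℚ(√-2)` (ring2-b02's `thirteen_not_mem_norm_two`).
* §2 literal classes with CELL IDENTIFICATIONS: the rigid curve `(0; 2:2222, 4b:84A, 8a:84B)` (`G₂`-signature `(2, 8A, 8B)`, genus 11233):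
  a `(3,3)` Weil-type SIXFOLD with `det H = -18/13`, `T = {2,13}` — **row `W6.2.13`** (pub-hsemireg TARGET-TABLE R4, `ℚ(√-2)`, `a = 13`; no
  product-window member was on record; CM points of record: ring2-b05 b05.11 Fermat points, habitat's simple CM point), its letter-mate
  `(0; 2:2222, 4b:84B, 8a:84A)` (`det H = -6/13`), and the `(2, 13A, 8A)` TENFOLD `(0; 2:2222, 4b:13A, 8a:84A)` of genus 15985 (coset genus 17):
  `(5,5)`, `det H = -3/208`, `T = {2,13}` — row `W10.2.13`; and §3 the ×2, on this seat's coset engine, of ring2-b02's `GL₂(3) × L₃(2)`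
  members of `W6.2.7` (census b02.21, 2026-08-23T16:43Z — the FIRST product-window members of that row): the rigid `(0; 2:22, 3:7A, 8a:42)`
  of genus 1321 (`det H = -1/336`) and the ONE-PARAMETER FAMILY `(0; 2:22, 3:33, 8a:42, e:22)` of genus 2185 (`det H = -1/3024`), both
  `(3,3)`, `T = {2,7}`, class `[7]` = b02's exact values' class — CONCUR.

No `def`, no named fact, no `sorry`; nothing here is a statement about Hodge classes; `HC_CM` is used nowhere.
References: [cite: vanGeemen1994HodgeAV, (5.4.1), Lemma 5.2].
-/

set_option linter.dupNamespace false

open Literature.AlgebraicGeometry.Motives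
open Literature.AlgebraicGeometry.VanGeemen1994
open Summit.HodgeConjecture.HodgeConjecture.Ring2.Hypotheses

namespace Summit.HodgeConjecture.HodgeConjecture.Ring2.WeilCoverage

/-! ### §1 The `SD₁₆ × PSL₃(3)` corollary of THEOREM S7's skeleton -/

/-- **`SD₁₆ × PSL₃(3)` on 13 points (`n = 13`, `|H₂| = 432`, `K = ℚ(√-2)`), `r₁ = 2j + 1` ODD, `m = 2k`, ANY carrier constant `u ≠ 0`:**
the class `[(13·432·u)^{r₁}·(432·u)^{r₁+m}]` predicted by THEOREM S7 is `[13]`, NOT a norm class from `ℚ(√-2)` (`13 ≡ 5 (mod 8)` inert;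
ring2-b02's `thirteen_not_mem_norm_two`): a Weil-type hidden factor with odd `r₁` lies on the NON-split row `W(m).2.13` — for `m = 6` the
row `(3, ℚ(√-2), [13])` of pub-hsemireg's R4; the rigid curve of §2 has `r₁ = 1`.
research route conditional on HC_CM; not a corollary; Q11.4-sentence-2 already refuted in dim ≥ 3. [cite: vanGeemen1994HodgeAV, (5.4.1)] -/
theorem carrierWindow_SD16L33_odd_not_mem_norm (u : ℚ) (hu : u ≠ 0) (j k : ℕ) :
    Units.mk0 ((((13 : ℕ) : ℚ) * 432 * u) ^ (2 * j + 1) * ((432 : ℚ) * u) ^ (2 * j + 1 + 2 * k))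
        (mul_ne_zero (pow_ne_zero _ (mul_ne_zero (mul_ne_zero (by norm_num) (by norm_num)) hu))
          (pow_ne_zero _ (mul_ne_zero (by norm_num) hu))) ∉ normUnitsSubgroup ℚ (weilField 2) := by
  intro hmem
  -- THEOREM S7's skeleton (part H `carrierWindow_mk_eq_mk_pow`) inlined with symbolic `n, h` (so that `ring` sees the square):
  -- `(n·h·u)^r (h·u)^{r+2k} · n^r = (n^r (h·u)^{r+k})²`
  have key : ∀ (n : ℕ) (h : ℚ) (r k' : ℕ) (hn : (n : ℚ) ≠ 0) (hh : h ≠ 0),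
      (QuotientGroup.mk (Units.mk0 (((n : ℚ) * h * u) ^ r * (h * u) ^ (r + 2 * k'))
        (mul_ne_zero (pow_ne_zero _ (mul_ne_zero (mul_ne_zero hn hh) hu)) (pow_ne_zero _ (mul_ne_zero hh hu)))) :
          weilNormResidueGroup 2) =
        QuotientGroup.mk (Units.mk0 ((n : ℚ) ^ r) (pow_ne_zero _ hn)) :=
    fun n h r k' hn hh => mk_eq_mk_of_mul_mem _ _
      (mem_normUnitsSubgroup_of_sq_add_mul_sq _ ((n : ℚ) ^ r * (h * u) ^ (r + k')) 0 (by ring))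
  have h1 := key 13 432 (2 * j + 1) k (by norm_num) (by norm_num)
  have h2 := mk_pow_odd_eq_mk 2 13 j (by norm_num)
  have h3 : (QuotientGroup.mk (Units.mk0 ((((13 : ℕ) : ℚ) * 432 * u) ^ (2 * j + 1) * ((432 : ℚ) * u) ^ (2 * j + 1 + 2 * k))
      (mul_ne_zero (pow_ne_zero _ (mul_ne_zero (mul_ne_zero (by norm_num) (by norm_num)) hu))
        (pow_ne_zero _ (mul_ne_zero (by norm_num) hu)))) : weilNormResidueGroup 2) =
      QuotientGroup.mk (Units.mk0 (13 : ℚ) (by norm_num)) := by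
    have := h1.trans (by exact_mod_cast h2)
    exact_mod_cast this
  have h4 : (QuotientGroup.mk (Units.mk0 (13 : ℚ) (by norm_num)) : weilNormResidueGroup 2) = 1 := by
    rw [← h3, QuotientGroup.eq_one_iff]
    exact hmem
  exact Summit.HodgeConjecture.Ring2WeilNormDescent.thirteen_not_mem_norm_two ((QuotientGroup.eq_one_iff _).1 h4)

/-! ### §2 Literal classes and cell identifications -/

/-- `SD₁₆ × PSL₃(3)` (semidihedral carrier of `ℚ(√-2)`; `PSL₃(3)` on the 13 points of `PG(2,3)`)-cover `(0; 2:2222,4b:84A,8a:84B)` (genus 11233, Hurwitz dimension 0; engine `cosetwin.py` on the coset cover `C̃/(H₁ × Stab(0))`, 104 sheets, genus 9, its own polarisation, exact): the HIDDEN FACTOR `B = V^{H₁×Stab(0)}` of the `(λ⊗ρ)`-piece `P` — an abelian SIXFOLD with `(3,3)` `ℚ(√-2)`-action, WEIL TYPE — has literal `det H|_B = -18/13`, `a = 18/13`, `T(a) = [2, 13]`: row `W6.2.13` (NON-split); `r₁ = dim_K H¹(C̃/G₂)_λ = 1`. THEOREM S7 (carrier-free product-window law, census b04.14 (A)) predicts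 `T(a_B) = [2, 13]` from `r₁ = 1` (`[a_B] = [n]^{r₁}`, `n = 13`) — CONFIRMED.
research route conditional on HC_CM; not a corollary; Q11.4-sentence-2 already refuted in dim ≥ 3. [cite: vanGeemen1994HodgeAV, (5.4.1)] -/
theorem pwSD16L33_22222_4b84A_8a84B_q0_g11233_mk_detH_ne_split :
    (QuotientGroup.mk (Units.mk0 (((-18 : ℚ) / 13)) (by norm_num)) : weilNormResidueGroup 2) ≠
      splitDiscriminantClass 3 2 := by
  have e : Units.mk0 (((-18 : ℚ) / 13)) (by norm_num) = -(Units.mk0 ((18 : ℚ) / 13) (by norm_num)) := Units.ext (by norm_num)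
  rw [Ne, e, mk_neg_eq_splitDiscriminantClass_iff_of_odd (n := 3) (by decide)]
  have h := mul_not_mem_normUnitsSubgroup (mem_normUnitsSubgroup_of_sq_add_mul_sq (d := 2) (a := ((18 : ℚ) / 169)) (by norm_num) (0 : ℚ) ((3 : ℚ) / 13) (by norm_num))
    Summit.HodgeConjecture.Ring2WeilNormDescent.thirteen_not_mem_norm_two
  rw [mk0_mul_mk0] at h
  norm_num at h
  exact h

/-- The same datum, CELL IDENTIFICATION: `[det H|_B] = [-13]` in `ℚˣ/Nm(ℚ(√-2)ˣ)` — the census ROW KEY of `W6.2.13` (`a·13 = (18 : ℚ) = ((0 : ℚ))² + 2·((3 : ℚ))²`).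
research route conditional on HC_CM; not a corollary; Q11.4-sentence-2 already refuted in dim ≥ 3. [cite: vanGeemen1994HodgeAV, Lemma 5.2 (3)] -/
theorem pwSD16L33_22222_4b84A_8a84B_q0_g11233_mk_detH_eq_key :
    (QuotientGroup.mk (Units.mk0 (-(((18 : ℚ) / 13))) (neg_ne_zero.2 (by norm_num))) : weilNormResidueGroup 2) =
      QuotientGroup.mk (Units.mk0 (-(13 : ℚ)) (neg_ne_zero.2 (by norm_num))) :=
  mk_neg_eq_mk_neg_of_mul_mem (by norm_num) (by norm_num)
    (mem_normUnitsSubgroup_of_sq_add_mul_sq _ (0 : ℚ) (3 : ℚ) (by norm_num))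

/-- `SD₁₆ × PSL₃(3)` (semidihedral carrier of `ℚ(√-2)`; `PSL₃(3)` on the 13 points of `PG(2,3)`)-cover `(0; 2:2222,4b:84B,8a:84A)` (genus 11233, Hurwitz dimension 0; engine `cosetwin.py` on the coset cover `C̃/(H₁ × Stab(0))`, 104 sheets, genus 9, its own polarisation, exact): the HIDDEN FACTOR `B = V^{H₁×Stab(0)}` of the `(λ⊗ρ)`-piece `P` — an abelian SIXFOLD with `(3,3)` `ℚ(√-2)`-action, WEIL TYPE — has literal `det H|_B = -6/13`, `a = 6/13`, `T(a) = [2, 13]`: row `W6.2.13` (NON-split); `r₁ = dim_K H¹(C̃/G₂)_λ = 1`. THEOREM S7 (carrier-free product-window law, census b04.14 (A)) predicts `T(a_B) = [2, 13]` from `r₁ = 1` (`[a_B] = [n]^{r₁}`, `n = 13`) — CONFIRMED.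
research route conditional on HC_CM; not a corollary; Q11.4-sentence-2 already refuted in dim ≥ 3. [cite: vanGeemen1994HodgeAV, (5.4.1)] -/
theorem pwSD16L33_22222_4b84B_8a84A_q0_g11233_mk_detH_ne_split :
    (QuotientGroup.mk (Units.mk0 (((-6 : ℚ) / 13)) (by norm_num)) : weilNormResidueGroup 2) ≠
      splitDiscriminantClass 3 2 := by
  have e : Units.mk0 (((-6 : ℚ) / 13)) (by norm_num) = -(Units.mk0 ((6 : ℚ) / 13) (by norm_num)) := Units.ext (by norm_num)
  rw [Ne, e, mk_neg_eq_splitDiscriminantClass_iff_of_odd (n := 3) (by decide)]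
  have h := mul_not_mem_normUnitsSubgroup (mem_normUnitsSubgroup_of_sq_add_mul_sq (d := 2) (a := ((6 : ℚ) / 169)) (by norm_num) ((-2 : ℚ) / 13) ((1 : ℚ) / 13) (by norm_num))
    Summit.HodgeConjecture.Ring2WeilNormDescent.thirteen_not_mem_norm_two
  rw [mk0_mul_mk0] at h
  norm_num at h
  exact h

/-- The same datum, CELL IDENTIFICATION: `[det H|_B] = [-13]` in `ℚˣ/Nm(ℚ(√-2)ˣ)` — the census ROW KEY of `W6.2.13` (`a·13 = (6 : ℚ) = ((-2 : ℚ))² + 2·((1 : ℚ))²`).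
research route conditional on HC_CM; not a corollary; Q11.4-sentence-2 already refuted in dim ≥ 3. [cite: vanGeemen1994HodgeAV, Lemma 5.2 (3)] -/
theorem pwSD16L33_22222_4b84B_8a84A_q0_g11233_mk_detH_eq_key :
    (QuotientGroup.mk (Units.mk0 (-(((6 : ℚ) / 13))) (neg_ne_zero.2 (by norm_num))) : weilNormResidueGroup 2) =
      QuotientGroup.mk (Units.mk0 (-(13 : ℚ)) (neg_ne_zero.2 (by norm_num))) :=
  mk_neg_eq_mk_neg_of_mul_mem (by norm_num) (by norm_num)
    (mem_normUnitsSubgroup_of_sq_add_mul_sq _ (-2 : ℚ) (1 : ℚ) (by norm_num))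

/-- `SD₁₆ × PSL₃(3)` (semidihedral carrier of `ℚ(√-2)`; `PSL₃(3)` on the 13 points of `PG(2,3)`)-cover `(0; 2:2222,4b:13A,8a:84A)` (genus 15985, Hurwitz dimension 0; engine `cosetwin.py` on the coset cover `C̃/(H₁ × Stab(0))`, 104 sheets, genus 17, its own polarisation, exact): the HIDDEN FACTOR `B = V^{H₁×Stab(0)}` of the `(λ⊗ρ)`-piece `P` — an abelian TENFOLD with `(5,5)` `ℚ(√-2)`-action, WEIL TYPE — has literal `det H|_B = -3/208`, `a = 3/208`, `T(a) = [2, 13]`: row `W10.2.13` (NON-split); `r₁ = dim_K H¹(C̃/G₂)_λ = 1`. THEOREM S7 (carrier-free product-window law, census b04.14 (A)) predicts `T(a_B) = [2, 13]` from `r₁ = 1` (`[a_B] = [n]^{r₁}`, `n = 13`) — CONFIRMED.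
research route conditional on HC_CM; not a corollary; Q11.4-sentence-2 already refuted in dim ≥ 3. [cite: vanGeemen1994HodgeAV, (5.4.1)] -/
theorem pwSD16L33_22222_4b13A_8a84A_q0_g15985_mk_detH_ne_split :
    (QuotientGroup.mk (Units.mk0 (((-3 : ℚ) / 208)) (by norm_num)) : weilNormResidueGroup 2) ≠
      splitDiscriminantClass 5 2 := by
  have e : Units.mk0 (((-3 : ℚ) / 208)) (by norm_num) = -(Units.mk0 ((3 : ℚ) / 208) (by norm_num)) := Units.ext (by norm_num)
  rw [Ne, e, mk_neg_eq_splitDiscriminantClass_iff_of_odd (n := 5) (by decide)]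
  have h := mul_not_mem_normUnitsSubgroup (mem_normUnitsSubgroup_of_sq_add_mul_sq (d := 2) (a := ((3 : ℚ) / 2704)) (by norm_num) ((1 : ℚ) / 52) ((1 : ℚ) / 52) (by norm_num))
    Summit.HodgeConjecture.Ring2WeilNormDescent.thirteen_not_mem_norm_two
  rw [mk0_mul_mk0] at h
  norm_num at h
  exact h

/-- The same datum, CELL IDENTIFICATION: `[det H|_B] = [-13]` in `ℚˣ/Nm(ℚ(√-2)ˣ)` — the census ROW KEY of `W10.2.13` (`a·13 = ((3 : ℚ) / 16) = (((1 : ℚ) / 4))² + 2·(((1 : ℚ) / 4))²`).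
research route conditional on HC_CM; not a corollary; Q11.4-sentence-2 already refuted in dim ≥ 3. [cite: vanGeemen1994HodgeAV, Lemma 5.2 (3)] -/
theorem pwSD16L33_22222_4b13A_8a84A_q0_g15985_mk_detH_eq_key :
    (QuotientGroup.mk (Units.mk0 (-(((3 : ℚ) / 208))) (neg_ne_zero.2 (by norm_num))) : weilNormResidueGroup 2) =
      QuotientGroup.mk (Units.mk0 (-(13 : ℚ)) (neg_ne_zero.2 (by norm_num))) :=
  mk_neg_eq_mk_neg_of_mul_mem (by norm_num) (by norm_num)
    (mem_normUnitsSubgroup_of_sq_add_mul_sq _ ((1 : ℚ) / 4) ((1 : ℚ) / 4) (by norm_num))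


/-! ### §3 ×2 of ring2-b02's `GL₂(3) × L₃(2)` members of `W6.2.7` (census b02.21) on the coset engine -/

/-- `GL₂(3) × L₃(2)` (`GL₂(3)` the degree-2 carrier of `ℚ(√-2)`, `H₁` = a reflection; `L₃(2) = PSL₂(7)` on 7 points; ring2-b02 b02.21's window, ×2 here)-cover `(0; 2:22,3:7A,8a:42)` (genus 1321, Hurwitz dimension 0; engine `cosetwin.py` on the coset cover `C̃/(H₁ × Stab(0))`, 168 sheets, genus 27, its own polarisation, exact): the HIDDEN FACTOR `B = V^{H₁×Stab(0)}` of the `(λ⊗ρ)`-piece `P` — an abelian SIXFOLD with `(3,3)` `ℚ(√-2)`-action, WEIL TYPE — has literal `det H|_B = -1/336`, `a = 1/336`, `T(a) = [2, 7]`: row `W6.2.7` (NON-split); `r₁ = dim_K H¹(C̃/G₂)_λ = 1`. THEOREM S7 (carrier-free product-window law, census b04.14 (A)) predicts `T(a_B) = [2, 7]` from `r₁ = 1` (`[a_B] = [n]^{r₁}`, `n = 7`) — CONFIRMED.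
research route conditional on HC_CM; not a corollary; Q11.4-sentence-2 already refuted in dim ≥ 3. [cite: vanGeemen1994HodgeAV, (5.4.1)] -/
theorem pwGL23L27_222_37A_8a42_q0_g1321_mk_detH_ne_split :
    (QuotientGroup.mk (Units.mk0 (((-1 : ℚ) / 336)) (by norm_num)) : weilNormResidueGroup 2) ≠
      splitDiscriminantClass 3 2 := by
  have e : Units.mk0 (((-1 : ℚ) / 336)) (by norm_num) = -(Units.mk0 ((1 : ℚ) / 336) (by norm_num)) := Units.ext (by norm_num)
  rw [Ne, e, mk_neg_eq_splitDiscriminantClass_iff_of_odd (n := 3) (by decide)]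
  have h := mul_not_mem_normUnitsSubgroup (mem_normUnitsSubgroup_of_sq_add_mul_sq (d := 2) (a := ((1 : ℚ) / 2352)) (by norm_num) ((1 : ℚ) / 84) ((1 : ℚ) / 84) (by norm_num))
    Summit.HodgeConjecture.Ring2WeilNormDescent.seven_not_mem_norm_two
  rw [mk0_mul_mk0] at h
  norm_num at h
  exact h

/-- The same datum, CELL IDENTIFICATION: `[det H|_B] = [-7]` in `ℚˣ/Nm(ℚ(√-2)ˣ)` — the census ROW KEY of `W6.2.7` (`a·7 = ((1 : ℚ) / 48) = (((1 : ℚ) / 12))² + 2·(((1 : ℚ) / 12))²`).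
research route conditional on HC_CM; not a corollary; Q11.4-sentence-2 already refuted in dim ≥ 3. [cite: vanGeemen1994HodgeAV, Lemma 5.2 (3)] -/
theorem pwGL23L27_222_37A_8a42_q0_g1321_mk_detH_eq_key :
    (QuotientGroup.mk (Units.mk0 (-(((1 : ℚ) / 336))) (neg_ne_zero.2 (by norm_num))) : weilNormResidueGroup 2) =
      QuotientGroup.mk (Units.mk0 (-(7 : ℚ)) (neg_ne_zero.2 (by norm_num))) :=
  mk_neg_eq_mk_neg_of_mul_mem (by norm_num) (by norm_num)
    (mem_normUnitsSubgroup_of_sq_add_mul_sq _ ((1 : ℚ) / 12) ((1 : ℚ) / 12) (by norm_num))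

/-- `GL₂(3) × L₃(2)` (`GL₂(3)` the degree-2 carrier of `ℚ(√-2)`, `H₁` = a reflection; `L₃(2) = PSL₂(7)` on 7 points; ring2-b02 b02.21's window, ×2 here)-cover `(0; 2:22,3:33,8a:42,e:22)` (genus 2185, Hurwitz dimension 1; engine `cosetwin.py` on the coset cover `C̃/(H₁ × Stab(0))`, 168 sheets, genus 27, its own polarisation, exact): the HIDDEN FACTOR `B = V^{H₁×Stab(0)}` of the `(λ⊗ρ)`-piece `P` — an abelian SIXFOLD with `(3,3)` `ℚ(√-2)`-action, WEIL TYPE — has literal `det H|_B = -1/3024`, `a = 1/3024`, `T(a) = [2, 7]`: row `W6.2.7` (NON-split); `r₁ = dim_K H¹(C̃/G₂)_λ = 1`. THEOREM S7 (carrier-free product-window law, census b04.14 (A)) predicts `T(a_B) = [2, 7]` from `r₁ = 1` (`[a_B] = [n]^{r₁}`, `n = 7`) — CONFIRMED.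
research route conditional on HC_CM; not a corollary; Q11.4-sentence-2 already refuted in dim ≥ 3. [cite: vanGeemen1994HodgeAV, (5.4.1)] -/
theorem pwGL23L27_222_333_8a42_e22_q0_g2185_mk_detH_ne_split :
    (QuotientGroup.mk (Units.mk0 (((-1 : ℚ) / 3024)) (by norm_num)) : weilNormResidueGroup 2) ≠
      splitDiscriminantClass 3 2 := by
  have e : Units.mk0 (((-1 : ℚ) / 3024)) (by norm_num) = -(Units.mk0 ((1 : ℚ) / 3024) (by norm_num)) := Units.ext (by norm_num)
  rw [Ne, e, mk_neg_eq_splitDiscriminantClass_iff_of_odd (n := 3) (by decide)]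
  have h := mul_not_mem_normUnitsSubgroup (mem_normUnitsSubgroup_of_sq_add_mul_sq (d := 2) (a := ((1 : ℚ) / 21168)) (by norm_num) ((1 : ℚ) / 252) ((1 : ℚ) / 252) (by norm_num))
    Summit.HodgeConjecture.Ring2WeilNormDescent.seven_not_mem_norm_two
  rw [mk0_mul_mk0] at h
  norm_num at h
  exact h

/-- The same datum, CELL IDENTIFICATION: `[det H|_B] = [-7]` in `ℚˣ/Nm(ℚ(√-2)ˣ)` — the census ROW KEY of `W6.2.7` (`a·7 = ((1 : ℚ) / 432) = (((1 : ℚ) / 36))² + 2·(((1 : ℚ) / 36))²`).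
research route conditional on HC_CM; not a corollary; Q11.4-sentence-2 already refuted in dim ≥ 3. [cite: vanGeemen1994HodgeAV, Lemma 5.2 (3)] -/
theorem pwGL23L27_222_333_8a42_e22_q0_g2185_mk_detH_eq_key :
    (QuotientGroup.mk (Units.mk0 (-(((1 : ℚ) / 3024))) (neg_ne_zero.2 (by norm_num))) : weilNormResidueGroup 2) =
      QuotientGroup.mk (Units.mk0 (-(7 : ℚ)) (neg_ne_zero.2 (by norm_num))) :=
  mk_neg_eq_mk_neg_of_mul_mem (by norm_num) (by norm_num)
    (mem_normUnitsSubgroup_of_sq_add_mul_sq _ ((1 : ℚ) / 36) ((1 : ℚ) / 36) (by norm_num))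

end Summit.HodgeConjecture.HodgeConjecture.Ring2.WeilCoverage
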